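import Mathlib
import Summits.KontsevichZagierPeriods.Zeta5Search.WedgeDictionaryClosedForms
import HarnessLib

/-!
# The two vanishing halves of the wedge-dictionary closed forms are theorems

Cell `pub-zeta5` (HONEST FRAMING: systematic search; no irrationality claim unless certified), planner seat
`pub-zeta5-gen-1` generation 4 (staged for the typer / prover seats; the planner cannot file).

`WedgeDictionaryClosedForms` (tree) states four items: the two CONJECTURED closed forms `casoratianClosedForm` (CF-M3)
and `QWedgeClosedForm` (CF-Q), and the two vanishing statements `casoratianVanishing`, `QWedgeVanishing`, marked there
`@[conjecture]` "expected routine".  This file PROVES the two vanishing statements: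

* `casoratianVanishing_holds` (via `quadM3_eq_zero_of_pair`): if one pair sum `b_j + b_k` exceeds `n = b₀` then
  `(X)_{n+1}² ∣ numPoly b` (`pochPoly_zero_dvd`), the cofactor has partial-fraction data of pole order `≤ 4`
  (`exists_pf_data` with `A = 4`), the order-padded data are data of `R_b`, so by uniqueness (`coeffU_eq`, `quadM3_eq`)
  `U(b) = 0` and the `W`-term of `quadM3 b` vanishes too: `coeffU b = 0 ∧ quadM3 b = 0`.
* `QWedgeVanishing_holds` (via `QOf_eq_zero_of_nonEpair`, which needs only `Converges a`): if one of the six pair sums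
  `16,17,27,35,45,46` exceeds `b₀` then in each case one and the same binomial factor of every term of Brown–Zudilin's
  double sum (17) vanishes (`16`: `p₆ < 0`; `17`: `k₂ < p₅`; `27`: `k₂ < p₆`; `45`: `k₁ − p₂ > q₂`; `46`: `p₀ < 0`;
  `35`, i.e. `a₈ < 0`: `k₁ < p₀` or `k₁ − p₂ > q₂`).
* `qPart_of_closedForms'`: hence the two conjectured closed forms CF-M3 and CF-Q ALONE imply the `Q`-part of
  `wedgeDictionary` in its j-free form `(QOf a : ℚ) = rhoOf a * quadM3 (bOfA a)` on the whole region.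

What remains open for the `Q`-part is exactly CF-M3 and CF-Q (both decided true per shape, symbolically in `n`, for all
shapes with `Σ b_j ≤ 16` resp. all ordered shapes with `Σ b_j ≤ 12` — exact computer algebra in the cell's
`code/gen1/g4/`, not formalised here).
-/

open Finset Polynomial

namespace Summit.KontsevichZagierPeriods.Zeta5Search.WedgeDictionary

open Summit.KontsevichZagierPeriods.Zeta5Search.DualSeries
open Literature.NumberTheory.Irrationality.BrownZudilin2022 (bOfA Converges convergenceForms QOf Qcoeff pOf qOf zchoose)
open Literature.NumberTheory.Transcendental (BallRivoal.poch)
open Literature.NumberTheory.Transcendental.BallRivoal (pochPoly eval_pochPoly pfEval)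
open Literature.NumberTheory.Irrationality.CressonFischlerRivoal2008 (exists_pf_data)

/-! ### The two vanishing statements are theorems -/

/-- Index bounds of `allPairs`. -/
theorem allPairs_bounds : ∀ jk ∈ allPairs, 1 ≤ jk.1 ∧ jk.1 < jk.2 ∧ jk.2 ≤ 7 := by decide

/-- `(X)_{B+1}` divides `(X)_m · (X + B + 1 − k)_k` as soon as the two factor ranges cover `0,…,B` (`m + k ≥ B + 1`). -/
theorem pochPoly_zero_dvd (B m k : ℕ) (β : ℚ) (hβ : β = ((B + 1 - k : ℕ) : ℚ)) (hk : k ≤ B + 1)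
    (h : B + 1 ≤ m + k) : pochPoly 0 (B + 1) ∣ pochPoly 0 m * pochPoly β k := by
  subst hβ
  have hf0 : ∀ N, pochPoly 0 N = ∏ u ∈ range N, (X + C (u : ℚ)) := fun N => by
    unfold pochPoly; exact prod_congr rfl fun u _ => by rw [zero_add]
  have hf1 : pochPoly ((B + 1 - k : ℕ) : ℚ) k = ∏ u ∈ Ico (B + 1 - k) (B + 1), (X + C (u : ℚ)) := by
    rw [prod_Ico_eq_prod_range, Nat.sub_sub_self hk]
    unfold pochPoly
    exact prod_congr rfl fun s _ => by rw [Nat.cast_add]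
  rw [hf0 (B + 1), hf0 m, hf1]
  have hsub : range (B + 1) ⊆ range m ∪ Ico (B + 1 - k) (B + 1) := fun u hu => by
    rw [mem_union, mem_range, mem_Ico]; rw [mem_range] at hu; omega
  exact (prod_dvd_prod_of_subset _ _ _ hsub).trans (Dvd.intro _ prod_union_inter)

/-- **Pole-order drop.** If two of the seven parameters have `b_{j+1} + b_{k+1} ≥ b₀ + 1` (all `b_i ≤ b₀`, `d ≥ 0`),
then `(X)_{b₀+1}² ∣ numPoly b`, so `R_b` has poles of order `≤ 4` only: `U(b) = 0` and `M₃(b) = 0`. -/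
theorem quadM3_eq_zero_of_pair (b : ℕ → ℤ) (hb : InBox b) (hd : 0 ≤ dOf b) (hle : ∀ j ∈ Icc 1 7, b j ≤ b 0)
    {j k : ℕ} (hj : j < 7) (hk : k < 7) (hjk : j ≠ k) (hsum : b 0 < b (j + 1) + b (k + 1)) :
    coeffU b = 0 ∧ quadM3 b = 0 := by
  obtain ⟨h0, hbox⟩ := hb
  have hB : (((b 0).toNat : ℕ) : ℤ) = b 0 := Int.toNat_of_nonneg h0
  have hnj : (((b (j + 1)).toNat : ℕ) : ℤ) = b (j + 1) := Int.toNat_of_nonneg (hbox j (mem_range.2 hj)).1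
  have hnk : (((b (k + 1)).toNat : ℕ) : ℤ) = b (k + 1) := Int.toNat_of_nonneg (hbox k (mem_range.2 hk)).1
  have hjle : b (j + 1) ≤ b 0 := hle (j + 1) (by rw [mem_Icc]; omega)
  have hkle : b (k + 1) ≤ b 0 := hle (k + 1) (by rw [mem_Icc]; omega)
  set B := (b 0).toNat with hBdef
  -- (1) divisibility of the numerator by `(X)_{B+1}²`
  have hdvd : pochPoly 0 (B + 1) ^ 2 ∣ numPoly b := by
    unfold numPoly
    set F : ℕ → ℚ[X] := fun i =>
      pochPoly 0 (b (i + 1)).toNat * pochPoly ((b 0 - b (i + 1) + 1 : ℤ) : ℚ) (b (i + 1)).toNat with hF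
    refine Dvd.dvd.mul_left ?_ _
    have hsplit : ∏ i ∈ range 7, F i = F j * (F k * ∏ i ∈ ((range 7).erase j).erase k, F i) := by
      rw [mul_prod_erase ((range 7).erase j) F (mem_erase.2 ⟨fun h => hjk h.symm, mem_range.2 hk⟩),
        mul_prod_erase (range 7) F (mem_range.2 hj)]
    rw [hsplit, ← mul_assoc, pow_two]
    refine Dvd.dvd.mul_right ?_ _
    have e : F j * F k =
        (pochPoly 0 (b (j + 1)).toNat * pochPoly ((b 0 - b (k + 1) + 1 : ℤ) : ℚ) (b (k + 1)).toNat) *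
          (pochPoly 0 (b (k + 1)).toNat * pochPoly ((b 0 - b (j + 1) + 1 : ℤ) : ℚ) (b (j + 1)).toNat) := by
      simp only [hF]; ring
    rw [e]
    refine mul_dvd_mul (pochPoly_zero_dvd B _ _ _ ?_ (by omega) (by omega))
      (pochPoly_zero_dvd B _ _ _ ?_ (by omega) (by omega))
    · rw [show (b 0 - b (k + 1) + 1 : ℤ) = ((B + 1 - (b (k + 1)).toNat : ℕ) : ℤ) by omega, Int.cast_natCast]
    · rw [show (b 0 - b (j + 1) + 1 : ℤ) = ((B + 1 - (b (j + 1)).toNat : ℕ) : ℤ) by omega, Int.cast_natCast]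
  obtain ⟨M, hM⟩ := hdvd
  -- (2) degree of the cofactor
  have hq : (pochPoly 0 (B + 1)).Monic := by
    unfold pochPoly; exact monic_prod_of_monic _ _ fun s _ => monic_X_add_C _
  have hqdeg : (pochPoly 0 (B + 1)).natDegree = B + 1 := by
    unfold pochPoly
    rw [natDegree_prod_of_monic _ _ fun s _ => monic_X_add_C _]
    simp only [natDegree_X_add_C, sum_const, card_range, smul_eq_mul, mul_one]
  have hsum' : ∑ i ∈ range 7, b (i + 1) ≤ 3 * b 0 + 1 := by unfold dOf at hd; omega
  have hdegN := natDegree_numPoly_add_two_le b ⟨h0, hbox⟩ hsum'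
  have hMdeg : (M.comp (X + C 1)).degree < ((4 * (B + 1) : ℕ) : WithBot ℕ) := by
    by_cases hM0 : M = 0
    · rw [hM0, zero_comp, degree_zero]; exact WithBot.bot_lt_coe _
    · have hq0 : pochPoly 0 (B + 1) ^ 2 ≠ 0 := pow_ne_zero _ hq.ne_zero
      have hdegM : (numPoly b).natDegree = 2 * (B + 1) + M.natDegree := by
        rw [hM, natDegree_mul hq0 hM0, natDegree_pow, hqdeg]
      have hnat : (M.comp (X + C 1)).natDegree = M.natDegree := by
        rw [natDegree_comp, natDegree_X_add_C, mul_one]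
      exact degree_le_natDegree.trans_lt (by rw [hnat]; exact_mod_cast (by omega))
  -- (3) partial-fraction data of pole order ≤ 4 for the cofactor, padded to six orders, are data of `R_b`
  obtain ⟨c4, hc4⟩ := exists_pf_data B 4 (by norm_num) _ hMdeg
  set c6 : ℕ → ℕ → ℚ := fun o p => if o < 4 then c4 o p else 0 with hc6def
  have hc6 : IsPFData b c6 := by
    intro t ht
    have hpoch : BallRivoal.poch (t + 1) (B + 1) ≠ 0 := by
      unfold BallRivoal.poch
      exact prod_ne_zero_iff.2 fun s hs h => ht s (Nat.lt_succ_iff.1 (mem_range.1 hs)) (by linarith)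
    have h64 : pfEval B 6 c6 t = pfEval B 4 c4 t := by
      unfold pfEval
      refine sum_congr rfl fun p _ => ?_
      rw [sum_range_succ, sum_range_succ]
      simp only [hc6def, show ¬ (4:ℕ) < 4 by norm_num, show ¬ (5:ℕ) < 4 by norm_num, if_false, zero_div, add_zero]
      exact sum_congr rfl fun o ho => by rw [if_pos (mem_range.1 ho)]
    rw [h64, hc4 t ht, hM]
    simp only [eval_comp, eval_mul, eval_pow, eval_add, eval_X, eval_C, eval_pochPoly, add_zero]
    rw [div_eq_div_iff (pow_ne_zero _ hpoch) (pow_ne_zero _ hpoch)]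
    ring
  -- (4) uniqueness of the data: `U(b) = Σ_p c6 4 p = 0`, and the order-4/5 sums in `quadM3` vanish
  have hU : coeffU b = 0 := by
    rw [coeffU_eq hc6]; exact sum_eq_zero fun p _ => by simp [hc6def]
  refine ⟨hU, ?_⟩
  rw [quadM3_eq hc6, hU]
  simp [hc6def]

/-- **`casoratianVanishing` is a theorem.** -/
theorem casoratianVanishing_holds : casoratianVanishing := by
  intro b hb hd hle hex
  obtain ⟨jk, hmem, hlt⟩ := hex
  obtain ⟨h1, h2, h3⟩ := allPairs_bounds jk hmem
  have hlt' : b 0 < b (jk.1 - 1 + 1) + b (jk.2 - 1 + 1) := by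
    rwa [Nat.sub_add_cancel h1, Nat.sub_add_cancel (by omega : 1 ≤ jk.2)]
  exact (quadM3_eq_zero_of_pair b hb hd hle (j := jk.1 - 1) (k := jk.2 - 1) (by omega) (by omega) (by omega) hlt').2

/-- `p₀ = a₅+a₆−a₈` (component of `pOf`/`qOf`, definitional). -/
theorem pOf_apply_0 (a : Fin 8 → ℤ) : pOf a 0 = a 4 + a 5 - a 7 := rfl
/-- `p₁` (component of `pOf`/`qOf`, definitional). -/
theorem pOf_apply_1 (a : Fin 8 → ℤ) : pOf a 1 = a 1 + a 2 + a 5 - a 3 - a 7 := rfl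
/-- `p₂ = a₆` (component of `pOf`/`qOf`, definitional). -/
theorem pOf_apply_2 (a : Fin 8 → ℤ) : pOf a 2 = a 5 := rfl
/-- `p₄ = a₇` (component of `pOf`/`qOf`, definitional). -/
theorem pOf_apply_4 (a : Fin 8 → ℤ) : pOf a 4 = a 6 := rfl
/-- `p₅` (component of `pOf`/`qOf`, definitional). -/
theorem pOf_apply_5 (a : Fin 8 → ℤ) : pOf a 5 = a 2 + a 5 - a 7 := rfl
/-- `p₆` (component of `pOf`/`qOf`, definitional). -/
theorem pOf_apply_6 (a : Fin 8 → ℤ) : pOf a 6 = a 0 + a 1 + a 5 - a 3 - a 7 := rfl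
/-- `q₁ = a₄` (component of `pOf`/`qOf`, definitional). -/
theorem qOf_apply_0 (a : Fin 8 → ℤ) : qOf a 0 = a 3 := rfl
/-- `q₂ = a₅` (component of `pOf`/`qOf`, definitional). -/
theorem qOf_apply_1 (a : Fin 8 → ℤ) : qOf a 1 = a 4 := rfl
/-- `q₄ = a₁` (component of `pOf`/`qOf`, definitional). -/
theorem qOf_apply_3 (a : Fin 8 → ℤ) : qOf a 3 = a 0 := rfl

/-- `zchoose n k = 0` off the range `0 ≤ k ≤ n`. -/
theorem zchoose_eq_zero {n k : ℤ} (h : k < 0 ∨ n < k) : zchoose n k = 0 := by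
  unfold zchoose; rw [if_neg]; omega

/-- **Every term of (17) vanishes off the six pair constraints** — on the whole convergence cone: writing the violated
constraint in the `aᵢ`, one fixed binomial factor of the summand is zero for every `(k₁, k₂)` in the summation box
(`16`: `p₆ < 0`; `17`: `k₂ < p₅`; `27`: `k₂ < p₆`; `45`: `k₁ − p₂ > q₂`; `46`: `p₀ < 0`; `35`, i.e. `a₈ < 0`:
`k₁ < p₀` or `k₁ − p₂ > q₂`). -/
theorem QOf_eq_zero_of_nonEpair (a : Fin 8 → ℤ) (hconv : Converges a)
    (hex : ∃ jk ∈ nonEpairs, bOfA a 0 < bOfA a jk.1 + bOfA a jk.2) : QOf a = 0 := by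
  have hf : ∀ x ∈ convergenceForms a, 0 ≤ x := hconv
  simp only [convergenceForms, List.mem_cons, List.not_mem_nil, or_false, forall_eq_or_imp, forall_eq] at hf
  obtain ⟨h0, h1, h2, h3, h4, h5, h6, -⟩ := hf
  simp only [nonEpairs, List.mem_cons, List.not_mem_nil, or_false, exists_eq_or_imp, exists_eq_left, bOfA] at hex
  unfold QOf Qcoeff
  refine mul_eq_zero_of_right _ (sum_eq_zero fun k₁ hk₁ => sum_eq_zero fun k₂ hk₂ => ?_)
  rw [mem_Icc, pOf_apply_1, qOf_apply_0] at hk₁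
  rw [mem_Icc, pOf_apply_4, qOf_apply_3] at hk₂
  rcases hex with h | h | h | h | h | h
  · rw [zchoose_eq_zero (n := k₂) (k := pOf a 6) (by rw [pOf_apply_6]; omega)]; ring
  · rw [zchoose_eq_zero (n := qOf a 4) (k := k₂ - pOf a 5) (by rw [pOf_apply_5]; omega)]; ring
  · rw [zchoose_eq_zero (n := k₂) (k := pOf a 6) (by rw [pOf_apply_6]; omega)]; ring
  · by_cases hk : k₁ < pOf a 0
    · rw [zchoose_eq_zero (n := k₁) (k := pOf a 0) (by omega)]; ring
    · rw [pOf_apply_0] at hk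
      rw [zchoose_eq_zero (n := qOf a 1) (k := k₁ - pOf a 2) (by rw [pOf_apply_2, qOf_apply_1]; omega)]; ring
  · rw [zchoose_eq_zero (n := qOf a 1) (k := k₁ - pOf a 2) (by rw [pOf_apply_2, qOf_apply_1]; omega)]; ring
  · rw [zchoose_eq_zero (n := k₁) (k := pOf a 0) (by rw [pOf_apply_0]; omega)]; ring

/-- **`QWedgeVanishing` is a theorem.** -/
theorem QWedgeVanishing_holds : QWedgeVanishing := fun a hconv _ _ hex => QOf_eq_zero_of_nonEpair a hconv hex



/-- **COROLLARY (PROVED): the two conjectured closed forms CF-M3 and CF-Q alone imply the `Q`-part of `wedgeDictionary`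
(`Q(a) = ρ(a)·M₃(b(a))`) on the whole region.** -/
theorem qPart_of_closedForms' (hM : casoratianClosedForm) (hQ : QWedgeClosedForm) (a : Fin 8 → ℤ)
    (hconv : Converges a) (hreg : ∀ i ∈ Icc 1 7, 0 ≤ bOfA a i ∧ 2 * bOfA a i ≤ bOfA a 0 + 1)
    (hd : 0 ≤ dOf (bOfA a)) : (QOf a : ℚ) = rhoOf a * quadM3 (bOfA a) :=
  qPart_of_closedForms hM casoratianVanishing_holds hQ QWedgeVanishing_holds a hconv hreg hd

end Summit.KontsevichZagierPeriods.Zeta5Search.WedgeDictionary
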